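import Summits.CriticalPhenomena.CardyFormulaZ2.Theorems.CardyBondTriangularBondTriangularCardyKiteBLabel
import Summits.CriticalPhenomena.CardyFormulaZ2.Theorems.CardyBondTriangularBondTriangularCardyKiteBReverse
import HarnessLib

/-!
# Route CardyBondTriangular · crux `BondTriangularCardy` · line `birth`: the blue arm of Claim 10 — the cycle of the kite interface, step by step

Helper of the stub `stub_blueArm` (Bollobás–Riordan, *Percolation* (2006), Ch. 7, Claim 10
pp. 178–179: "Suppose next that the component of `I` containing `f` is a cycle"). The walk of the
kite interface (`…KiteBDarts`–`…KiteBLabel`) read step by step, for the port of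
`TriClaim10Cycle.lean` (site version, §CycleFacts): the right cells (hexagons of the yellow kites)
are successively equal or adjacent, yellow-adjacent when both in `G` (the necklace walk,
`cyc_exists_necklace_walk`), never pure blue; a cell is a vertex of the corner of its kite; and
the three transitions at the boundary — between two outer right cells the boundary dart from the
left cell is kept or advances by the boundary successor (`trans_out_out`), an outer block is left
either by the boundary successor or by diving into the left hexagon (`trans_out_in`), and entered
either around a corner (the new dart from the left cell is the successor of the entry dart) or by
emerging from a split hexagon onto the boundary (`trans_in_out`).

## References

* B. Bollobás, O. Riordan, *Percolation*, CUP (2006), Ch. 7, Claim 10 pp. 178–179, Fig. 15.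
-/

namespace Summit.CriticalPhenomena.CardyFormulaZ2.Theorems.BondTriangularCardyLine.KiteB

open Literature.Probability.Percolation Literature.Probability.LatticeModels
open TriMarkedDomain (fin3_add_one_add_one fin3_add_two_add_one fin3_add_two_add_two fin3_add_one_add_two)

/-! ### Cells are vertices of the corners of their kites -/

/-- **The right cell is a vertex of the corner of the right kite** (registered anchor of this file). -/
theorem rightCell_mem_rightCorner : ∀ {d : Summit.CriticalPhenomena.CardyFormulaZ2.Theorems.BondTriangularCardyLine.KiteB.KDart}, d.adm = true → d.rightCell ∈ Literature.Probability.LatticeModels.hexFaceVertices d.rightCorner := by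
  intro d hadm
  cases d with
  | toMid F j => exact faceVertex_mem _ _
  | fromMid F j => exact faceVertex_mem _ _
  | toCtr x y => exact (mem_leftFace_four ((KDart.adm_toCtr x y).1 hadm)).1
  | fromCtr x y => exact (mem_leftFace_four ((KDart.adm_fromCtr x y).1 hadm)).2.2.1

/-- The left cell is a vertex of the corner of the left kite. -/
theorem leftCell_mem_leftCorner {d : KDart} (hadm : d.adm = true) : d.leftCell ∈ hexFaceVertices d.leftCorner := by
  cases d with
  | toMid F j => exact faceVertex_mem _ _
  | fromMid F j => exact faceVertex_mem _ _
  | toCtr x y => exact (mem_leftFace_four ((KDart.adm_toCtr x y).1 hadm)).2.2.1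
  | fromCtr x y => exact (mem_leftFace_four ((KDart.adm_fromCtr x y).1 hadm)).1

section Trans

variable {D : TriMarkedDomain 3} {σ : CLHexConfig}

/-- A right cell in `G` is not pure blue (its kite on the right is yellow). -/
theorem rightCell_ne_B {d : KDart} (hd : iface (kcol D σ) d = true) (hadm : d.adm = true) (hin : d.rightCell ∈ D.verts) :
    σ d.rightCell ≠ CLHexState.B := by
  rw [iface_iff'] at hd
  have h := hd.2
  rw [ccol_of_mem hin (rightCell_mem_rightCorner hadm), decide_eq_true_eq] at h
  intro hB; rw [hB] at h; exact h

/-- **Between two outer right cells**: the boundary dart from the left cell is kept, or advances by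
the boundary successor. -/
theorem trans_out_out {d : KDart} (hd : iface (kcol D σ) d = true) (hadm : d.adm = true) (hG : d.leftCell ∈ D.verts)
    (hG' : (succ (kcol D σ) d).leftCell ∈ D.verts) (hout : d.rightCell ∉ D.verts)
    (hout' : (succ (kcol D σ) d).rightCell ∉ D.verts) :
    ((succ (kcol D σ) d).leftCell, (succ (kcol D σ) d).rightCell) = (d.leftCell, d.rightCell) ∨
      ((succ (kcol D σ) d).leftCell, (succ (kcol D σ) d).rightCell) = triBdrySucc D.verts (d.leftCell, d.rightCell) := by
  cases d with
  | toMid F j =>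
    simp only [KDart.leftCell, KDart.rightCell] at hG hout ⊢
    simp only [succ] at hG' hout' ⊢
    split_ifs at hG' hout' ⊢ with h1 h2
    · exact absurd hG hout'
    · left; simp only [faceVertex_oppFace_succ, faceVertex_oppFace_succ_succ]
    · exact absurd hG' hout
  | fromMid F j =>
    simp only [KDart.leftCell, KDart.rightCell] at hG hout ⊢
    have hs := D.succ_faceDart₃ (F := F) (j := j + 1)
    rw [fin3_add_one_add_one, fin3_add_one_add_two] at hs
    simp only [succ] at hG' hout' ⊢
    split_ifs at hG' hout' ⊢ with h1
    · right
      simp only [KDart.rightCell, fin3_add_two_add_two, fin3_add_two_add_one] at hout' ⊢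
      rw [hs, if_neg hout']
    · right
      simp only [KDart.leftCell, fin3_add_one_add_two, fin3_add_one_add_one] at hG' ⊢
      rw [hs, if_pos hG']
  | toCtr x y => exact absurd hG hout
  | fromCtr x y => exact absurd hG hout

/-- **Leaving an outer block**: the new right cell (in `G`) is the old left cell (the walk dives
into it along its split line), or the dart from it to the old right cell is the boundary
successor of the dart from the old left cell, a yellow boundary dart, the left cell being kept. -/
theorem trans_out_in {d : KDart} (hd : iface (kcol D σ) d = true) (hadm : d.adm = true) (hG : d.leftCell ∈ D.verts)
    (hG' : (succ (kcol D σ) d).leftCell ∈ D.verts) (hout : d.rightCell ∉ D.verts)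
    (hin' : (succ (kcol D σ) d).rightCell ∈ D.verts) :
    (succ (kcol D σ) d).rightCell = d.leftCell ∨
      (((succ (kcol D σ) d).rightCell, d.rightCell) = triBdrySucc D.verts (d.leftCell, d.rightCell) ∧
        (succ (kcol D σ) d).rightCell ≠ d.leftCell ∧ (succ (kcol D σ) d).leftCell = d.leftCell ∧
        D.stretchIdx₃ (D.dpos ((succ (kcol D σ) d).rightCell, d.rightCell)) ≠ 0) := by
  have hd' := hd
  rw [iface_iff'] at hd
  obtain ⟨-, hr⟩ := hd
  cases d with
  | toMid F j =>
    simp only [KDart.leftCell, KDart.rightCell, KDart.rightCorner] at hG hout hr ⊢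
    simp only [succ] at hG' hin' ⊢
    split_ifs at hG' hin' ⊢ with h1 h2
    · exact Or.inl rfl
    · simp only [KDart.rightCell, faceVertex_oppFace_succ_succ] at hin'; exact absurd hin' hout
    · exact absurd hG' hout
  | fromMid F j =>
    simp only [KDart.leftCell, KDart.rightCell, KDart.rightCorner] at hG hout hr ⊢
    have hs := D.succ_faceDart₃ (F := F) (j := j + 1)
    rw [fin3_add_one_add_one, fin3_add_one_add_two] at hs
    simp only [succ] at hG' hin' ⊢
    split_ifs at hG' hin' ⊢ with h1
    · right
      simp only [KDart.rightCell, fin3_add_two_add_two, fin3_add_two_add_one] at hin' ⊢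
      rw [hs, if_pos hin']
      refine ⟨by trivial, fun e => absurd (faceVertex_injective F e) (by simp), by trivial, ?_⟩
      -- the colour of the old right cell, viewed from the new one, is the one viewed from the left cell
      have hv := D.bdryCol_views_eq₃ (F := F) (j := j + 2) hout (by rw [fin3_add_two_add_one]; exact hin')
        (by rw [fin3_add_two_add_two]; exact hG)
      rw [fin3_add_two_add_two, fin3_add_two_add_one] at hv
      rw [ccol_faceVertex, ← ccol_faceVertex, ccol_of_not_mem hout hG (faceVertex_mem _ _) (faceVertex_mem _ _), hv] at hr
      unfold TriMarkedDomain.bdryCol₃ TriMarkedDomain.bcolOf₃ at hr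
      simpa using hr
    · simp only [KDart.rightCell, fin3_add_one_add_one] at hin'; exact absurd hin' hout
  | toCtr x y => exact absurd hG hout
  | fromCtr x y => exact absurd hG hout

/-- **Entering an outer block**: the dart from the old right cell to the new (outer) one is a
yellow boundary dart, and the new dart from the left cell is either its boundary successor (the
left cell is kept, being the apex; the old cells are distinct) or that dart itself (the walk
emerges from the old right cell, which becomes the left cell). -/
theorem trans_in_out {d : KDart} (hd : iface (kcol D σ) d = true) (hadm : d.adm = true) (hG : d.leftCell ∈ D.verts)
    (hG' : (succ (kcol D σ) d).leftCell ∈ D.verts) (hin : d.rightCell ∈ D.verts)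
    (hout' : (succ (kcol D σ) d).rightCell ∉ D.verts) :
    (d.rightCell, (succ (kcol D σ) d).rightCell) ∈ triBdryDarts D.verts ∧
      D.stretchIdx₃ (D.dpos (d.rightCell, (succ (kcol D σ) d).rightCell)) ≠ 0 ∧
      ((((succ (kcol D σ) d).leftCell, (succ (kcol D σ) d).rightCell) =
          triBdrySucc D.verts (d.rightCell, (succ (kcol D σ) d).rightCell) ∧ d.leftCell ≠ d.rightCell ∧
          (succ (kcol D σ) d).leftCell = d.leftCell) ∨
        ((succ (kcol D σ) d).leftCell, (succ (kcol D σ) d).rightCell) = (d.rightCell, (succ (kcol D σ) d).rightCell)) := by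
  cases d with
  | toMid F j =>
    simp only [KDart.leftCell, KDart.rightCell] at hG hin ⊢
    simp only [succ] at hG' hout' ⊢
    split_ifs at hG' hout' ⊢ with h1 h2
    · exact absurd hG hout'
    · simp only [KDart.rightCell, faceVertex_oppFace_succ_succ] at hout'; exact absurd hin hout'
    · exact absurd hin hout'
  | fromMid F j =>
    simp only [KDart.leftCell, KDart.rightCell] at hG hin ⊢
    have hs := D.succ_faceDart₃ (F := F) (j := j + 2)
    rw [fin3_add_two_add_one, fin3_add_two_add_two] at hs
    simp only [succ] at hG' hout' ⊢
    split_ifs at hG' hout' ⊢ with h1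
    · simp only [KDart.rightCell, fin3_add_two_add_two, fin3_add_two_add_one] at hout' ⊢
      have hadj : triGraph.Adj (faceVertex F (j + 2)) (faceVertex F j) := by
        have := TriMarkedDomain.adj_faceVertex_succ F (j + 2); rwa [fin3_add_two_add_one] at this
      refine ⟨mem_triBdryDarts.2 ⟨hin, hout', hadj⟩, ?_, Or.inl ⟨by rw [hs, if_pos hG], fun e => absurd (faceVertex_injective F e) (by simp), by trivial⟩⟩
      have hv := D.bdryCol_views_eq₃ (F := F) (j := j) hout' hG hin
      have hc : kcol D σ F j = D.bdryCol₃ (D.dpos (faceVertex F (j + 1), faceVertex F j)) := by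
        unfold kcol; rw [if_neg hout', if_pos hG]
      rw [hc, ← hv] at h1
      unfold TriMarkedDomain.bdryCol₃ TriMarkedDomain.bcolOf₃ at h1
      simpa using h1
    · simp only [KDart.rightCell, fin3_add_one_add_one] at hout'; exact absurd hin hout'
  | toCtr x y => exact absurd hG' hout'
  | fromCtr x y =>
    simp only [KDart.leftCell, KDart.rightCell] at hG hin ⊢
    have h := (KDart.adm_fromCtr x y).1 hadm
    obtain ⟨hx, hy⟩ := faceVertex_kidx_leftFace h
    obtain ⟨hy', hx'⟩ := faceVertex_kidx_leftFace h.symm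
    obtain ⟨m1, m2, -, -⟩ := mem_leftFace_four h
    simp only [succ, kc_kcol] at hG' hout' ⊢
    split_ifs at hG' hout' ⊢ with h1 h2
    · simp only [KDart.rightCell, fin3_add_two_add_two, fin3_add_two_add_one, hx, hy] at hout' ⊢
      refine ⟨mem_triBdryDarts.2 ⟨hin, hout', h⟩, ?_, Or.inr (by trivial)⟩
      rw [ccol_of_not_mem hout' hin m2 m1] at h1
      unfold TriMarkedDomain.bdryCol₃ TriMarkedDomain.bcolOf₃ at h1
      simpa using h1
    · exact absurd hG' hout'
    · simp only [KDart.rightCell, fin3_add_two_add_two, hx'] at hout'; exact absurd hin hout'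

end Trans

/-! ### Along the cycle -/

section CycleFacts

variable (D : TriMarkedDomain 3) {σ : CLHexConfig} {orb : ℕ → KDart} {N : ℕ}
  (horb : ∀ k < N, succ (kcol D σ) (orb k) = orb (k + 1))
  (hiface : ∀ k < N, iface (kcol D σ) (orb k) = true) (hadm : ∀ k < N, (orb k).adm = true)
  (hleft : ∀ k < N, (orb k).leftCell ∈ D.verts)

include horb hiface hadm hleft in
/-- **Consecutive right cells are equal or adjacent, and then yellow at a common corner.** -/
theorem cyc_rightCell_succ {k : ℕ} (hk : k + 1 < N) :
    (orb (k + 1)).rightCell = (orb k).rightCell ∨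
      (triGraph.Adj (orb k).rightCell (orb (k + 1)).rightCell ∧ ∃ G : HexVertex,
        (orb k).rightCell ∈ hexFaceVertices G ∧ (orb (k + 1)).rightCell ∈ hexFaceVertices G ∧
        ccol D σ (orb k).rightCell G = true ∧ ccol D σ (orb (k + 1)).rightCell G = true) := by
  rw [← horb k (by omega)]
  exact rightCell_succ (hiface k (by omega)) (hadm k (by omega)) (hleft k (by omega))

include horb hiface hadm hleft in
/-- Consecutive distinct right cells in `G` are yellow-adjacent. -/
theorem cyc_clYellow_adj {k : ℕ} (hk : k + 1 < N) (hne : (orb k).rightCell ≠ (orb (k + 1)).rightCell)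
    (h1 : (orb k).rightCell ∈ D.verts) (h2 : (orb (k + 1)).rightCell ∈ D.verts) :
    (clYellowGraph σ).Adj (orb k).rightCell (orb (k + 1)).rightCell := by
  rcases cyc_rightCell_succ D horb hiface hadm hleft hk with h | ⟨hadj, G, m1, m2, c1, c2⟩
  · exact absurd h.symm hne
  · rw [ccol_of_mem h1 m1, decide_eq_true_eq] at c1
    rw [ccol_of_mem h2 m2, decide_eq_true_eq] at c2
    exact (clYellowGraph_adj_iff σ _ _).2 ⟨hadj, G, m1, m2, c1, c2⟩

include horb hiface hadm hleft in
/-- **The necklace walk** (`TriClaim10Cycle.cyc_exists_necklace_walk`, verbatim): the right cells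
`ρᵣ, …, ρ_{r+n}` carry a walk of `𝕋` whose darts are the pairs of distinct consecutive right
cells. -/
theorem cyc_exists_necklace_walk (r : ℕ) :
    ∀ n, r + n < N → ∃ W : triGraph.Walk (orb r).rightCell (orb (r + n)).rightCell,
      (∀ x ∈ W.support, ∃ k, r ≤ k ∧ k ≤ r + n ∧ x = (orb k).rightCell) ∧
      (∀ d ∈ W.darts, ∃ k, r ≤ k ∧ k < r + n ∧ (orb k).rightCell ≠ (orb (k + 1)).rightCell ∧
        d.toProd = ((orb k).rightCell, (orb (k + 1)).rightCell)) := by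
  intro n
  induction n with
  | zero =>
    intro _
    exact ⟨SimpleGraph.Walk.nil, fun x hx => ⟨r, le_rfl, by omega, by simpa using hx⟩, fun d hd => by simp at hd⟩
  | succ n ih =>
    intro hn
    obtain ⟨W, hWs, hWd⟩ := ih (by omega)
    rw [show r + (n + 1) = r + n + 1 by omega]
    by_cases heq : (orb (r + n + 1)).rightCell = (orb (r + n)).rightCell
    · refine ⟨W.copy rfl heq.symm, fun x hx => ?_, fun d hd => ?_⟩
      · rw [SimpleGraph.Walk.support_copy] at hx
        obtain ⟨k, h1, h2, h3⟩ := hWs x hx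
        exact ⟨k, h1, by omega, h3⟩
      · rw [SimpleGraph.Walk.darts_copy] at hd
        obtain ⟨k, h1, h2, h3, h4⟩ := hWd d hd
        exact ⟨k, h1, by omega, h3, h4⟩
    · have hadj : triGraph.Adj (orb (r + n)).rightCell (orb (r + n + 1)).rightCell := by
        rcases cyc_rightCell_succ D horb hiface hadm hleft (show r + n + 1 < N by omega) with h | ⟨h, -⟩
        · exact absurd h heq
        · exact h
      refine ⟨W.concat hadj, fun x hx => ?_, fun d hd => ?_⟩
      · rw [SimpleGraph.Walk.support_concat, List.mem_append, List.mem_singleton] at hx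
        rcases hx with hx | rfl
        · obtain ⟨k, h1, h2, h3⟩ := hWs x hx
          exact ⟨k, h1, by omega, h3⟩
        · exact ⟨r + n + 1, by omega, le_rfl, rfl⟩
      · rw [SimpleGraph.Walk.darts_concat, List.concat_eq_append, List.mem_append, List.mem_singleton] at hd
        rcases hd with hd | rfl
        · obtain ⟨k, h1, h2, h3, h4⟩ := hWd d hd
          exact ⟨k, h1, by omega, h3, h4⟩
        · exact ⟨r + n, by omega, by omega, fun h => heq h.symm, rfl⟩

variable {Q : List (Site 2)} (hQ : Q ≠ [])
  (hQY : ∀ d ∈ pathDarts Q, ∃ G : HexVertex, d.1 ∈ hexFaceVertices G ∧ d.2 ∈ hexFaceVertices G ∧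
    ccol D σ d.1 G = true ∧ ccol D σ d.2 G = true)
  {nv len : ℕ}
  (hlast : ∃ G : HexVertex, Q.getLast hQ ∈ hexFaceVertices G ∧ D.bdryHead nv ∈ hexFaceVertices G ∧
    ccol D σ (Q.getLast hQ) G = true)
  (hhead : ∃ G : HexVertex, Q.head hQ ∈ hexFaceVertices G ∧ D.bdryHead (nv + len) ∈ hexFaceVertices G ∧
    ccol D σ (Q.head hQ) G = true)

include horb hiface hadm hleft hQY hlast hhead in
/-- **The walk never crosses the chord loop of a yellow path**: the label of the corner of the
left kite is constant along the cycle (`faceLabel_leftCorner_succ` at each step). -/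
theorem cyc_faceLabel_leftCorner_eq (hC : ∀ d ∈ cycDarts (D.chordLoop Q nv len), triGraph.Adj d.1 d.2)
    (hN : (orb N).leftCell ∈ D.verts) :
    ∀ k ≤ N, faceLabel (cycDarts (D.chordLoop Q nv len)) (orb k).leftCorner =
      faceLabel (cycDarts (D.chordLoop Q nv len)) (orb 0).leftCorner := by
  intro k
  induction k with
  | zero => intro; rfl
  | succ k ih =>
    intro hk
    rw [← ih (by omega), ← horb k (by omega)]
    refine faceLabel_leftCorner_succ hQ hQY hlast hhead hC (hiface k (by omega)) (hadm k (by omega)) (hleft k (by omega)) ?_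
    rw [horb k (by omega)]
    by_cases h : k + 1 < N
    · exact hleft (k + 1) h
    · rw [show k + 1 = N by omega]; exact hN

end CycleFacts

end Summit.CriticalPhenomena.CardyFormulaZ2.Theorems.BondTriangularCardyLine.KiteB
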